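/-
Copyright (c) 2026 the pub-hodgecm-mathlib formalisation cell (harness21).  Prover seat hodgecm-mathlib-LH3-p03 (g4) on line LH3 (closer stub `stub_N9`, N9 «Transf» direct
road), organ J, brick (G′-CANCEL) = LH3-plan (g3) RULINGS #8 (iii) ∕ #9 (ii): the LH3 dress of ★ `InvariantQuotientBlockDescent` — `K = Kβ`; 2026-09-02.
-/
import Literature.MeasureTheory.Group.InvariantQuotientBlockDescent            -- ★ p850497 (this seat): `exists_smul_map_mk_of_block_compact`, `exists_smul_eq_of_block_boxNormalised`, `toReal_mul_eq_toReal_mul_of_pinning`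
import Literature.NumberTheory.Rogawski1990.ArchChartOrbGBlockReduction         -- ★ p850417 (F0P3-p02 (g18)) (J-G′-BLOCK): the `hmap` binder; brings ★ D4b (`isClosed_subgroupOf_of_isClosed`, `continuous_subgroupOfEquivOfLe`, `is…_map_subgroupOfEquivOfLe_symm`, `isMulRightInvariant_of_isInvInvariant`), ★ (T-MEAS-G′) `chartHaarG`, `chartBoxImgG`
import Literature.NumberTheory.Automorphic.ArchRankOneSplitOrbitContinuity       -- ★ p850189 (F0P3a-p05 (g19)) (A0-b): `hypBlockGL_mem_of_eq_over`, `hypBlockGL_mem_torusU`; brings `torusU`, `LineRing.isClosed_torusU_two`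
import HarnessLib

/-!
# (G′-CANCEL): the descent constants of `chartOrbG` on the compact chart `S` and on the Cayley chart `insert w S` AGREE — `dt′(B′)·κ = dt′(B′♯)·κβ`
# (Rogawski 1990 §8.2 pp. 119–124, §4.12; Folland 1995 §2.6 (2.52); Deitmar–Echterhoff 2014 Thm. 1.5.3)

Topic `NumberTheory/Rogawski1990`; namespace `Literature.NumberTheory.Rogawski1990`.  THEOREMS ONLY (no `def`, no instance, no notation, no axiom, no named fact, no `sorry`);
kernel lane `--kind proof --supports stmt-HodgeConjecture-24833`.  Cell `pub/hodgecm-mathlib`, crux H413 (`stmt-HodgeConjecture-24833`), F0∕P3c line LH3 (closer stub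
`stub_N9`, DIRECT ROAD `F0_P3c_StubN9Direct`, organ J `JumpAgreementStatement` ∕ residual `stub_N9jumpBricks`), brick **(G′-CANCEL)** (LH3-plan (g3) RULINGS #8 (iii),
#9 (ii), 2026-09-02; seat LH3-p03 (g4)).  After (B-STD) (★ p850476∕p850488: the block `B` of (M-UNFOLD) ★ p850446 IS `U(J)`, `hJ : J = (StdForm.antidiagonal 2).over ℂ`, with the
shared Haar `μ₀`), the (G′) jump constant of organ J is `i · K · C₁ ∕ (Kβ · C₂)` (★ `hasOneSidedJump_orbFamGExt_side_of_bricks_explicit`, LH3-p02 (g2∕g3)) with the SHARED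
rank-one constants `C₁, C₂` (LH4-p03 (g4) cert v3) and the two DESCENT CONSTANTS `K = dt′(B′)·κ` (compact chart `S`, ★ p850417's `hmap`: `Ψ_* (νM ∕ dt′_S) = κ • π_* μ₀`) and
`Kβ = dt′(B′♯)·κβ` (Cayley chart `insert w S`, ★ p850444's `hmapβ`: `Ψβ_* (νM ∕ dt′♯) = κβ • μ₀′`, `μ₀′ = ρ(B_std) • (μ₀ ∕ ρ)` the box-normalised quotient, LH4-p03's `hlink`).
LH3-p02 (g3)'s ED. 3 `hasOneSidedJump_orbFamGExt_side_of_bricks_std` (★ p850473) reads ONE `K` on both charts, i.e. it needs **`K = Kβ`** — this file.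

THE MATHEMATICS.  Both quotient measures are descents of the SAME Haar measure `νM` of `Z(s)` through the SAME block splitting `e′ : Z(s) ≃ₜ* U(J) × K` (★ (M-UNFOLD) ∘ (B-STD)),
the chart tori being `T′_S = e′⁻¹(A_c × K)` (`A_c` the compact Cayley torus) and `T′♯ = e′⁻¹(T_split × K)`.  By ★ `InvariantQuotientBlockDescent` each descent scalar is PINNED:
`κ · dt′_S{t ∣ (e′ t).2 ∈ F} · μ₀(E) = νM(e′⁻¹(E × F))` and `κβ · dt′♯{t ∣ (e′ t).1 ∈ B_std, (e′ t).2 ∈ F} · μ₀(E) = νM(e′⁻¹(E × F))` for all `E ⊆ U(J)`, `F ⊆ K`.  The two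
chart boxes are `B′_S = e′⁻¹(A_c × K□)` and `B′♯ = e′⁻¹(B_std × K□)` with the SAME `K`-shadow `K□` (the `w`-degenerate part of ★ `chartBox`: angle `θ₁` at `w`, every coordinate at
`w′ ≠ w`; ★ (M-UNFOLD) clauses [5]∕[6] and their Cayley twins), and `B_std = {hypBlockGL x θ ∣ x ∈ [0,1], θ ∈ [0,2π]}` is EXACTLY the box normalising `μ₀′`.  Taking `F := K□`
and one `E` of finite positive mass: `κ · dt′_S(B′_S) · μ₀(E) = νM(e′⁻¹(E × K□)) = κβ · dt′♯(B′♯) · μ₀(E)`, whence `dt′_S(B′_S) · κ = dt′♯(B′♯) · κβ`.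
The head **`exists_hmap_hmapβ_descentConst_eq`** delivers, in BINDER form over the abstract `e′` (LH3-plan (g3) 2026-09-02T08:22:51Z (1): `ContinuousMulEquiv.prodCongr` does not
exist — never spell the composite), the compact abelian `A ≤ U(J)`, the closed abelian `K ≤ Z(s)`, `Ψ hΨ Ψβ hΨβ` (★ p850477 tokens), D4b's `νM`, the shared `μ₀ μ₀′` with `hlink`
(cert v3 text), ONE box-positive Haar `σ` on the split torus (LH4-p03's (DATUM-DISCHARGE): `σ B_std = 1`) and the two BOX CLAUSES: **`∃ κ κβ ≠ 0` with ★ p850417's `hmap`,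
★ p850444's `hmapβ` (token for token, `νB := μ₀`, `μ := μ₀′`) and `(dt′_S B′_S).toReal * κ = (dt′♯ B′♯).toReal * κβ`**.
HONEST LABEL: HC_CM is proved only modulo the 7 printed citations (2 remaining named inputs: hLiu418 = `stmt-HodgeConjecture-24832`, h413 = `stmt-HodgeConjecture-24833`) until rung 0
closes; count-neutral measure bookkeeping under organ J of `stub_N9` (the box clauses are ★ (M-UNFOLD)'s [5]∕[6]∕[5β]∕[6β], discharged by their owner or in ED. 2 here).

## References
* [Rogawski1990] J. D. Rogawski, *Automorphic Representations of Unitary Groups in Three Variables*, Ann. of Math. Stud. 123 (1990), §4.12 Lemma 4.12.1 p. 66 (descent to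
  `M = U(1,1) × …`), §8.2 pp. 119–124 (p. 122: the same `U(1,1)`-block read on the compact torus `(θ+ψ, θ₁, θ−ψ)` and on the Cayley torus; the normalisation of `dt`).
* [Folland1995] G. B. Folland, *A Course in Abstract Harmonic Analysis* (1995), §2.2 (uniqueness of Haar measure), §2.6 Thm. 2.49, (2.52).
* [DeitmarEchterhoff2014] A. Deitmar, S. Echterhoff, *Principles of Harmonic Analysis*, 2nd ed. (2014), Thm. 1.5.3, Cor. 1.5.4.
* [Shelstad1979] D. Shelstad, *Characters and inner forms of a quasi-split group over ℝ*, Compositio Math. 39 (1979), §4 pp. 22–25 (`d(α)` is independent of the normalisations).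
-/

set_option autoImplicit false

noncomputable section

open MeasureTheory MeasureTheory.Measure Set Topology NumberField NumberField.InfinitePlace
open Literature.MeasureTheory.Group Literature.NumberTheory.Automorphic Literature.NumberTheory.Automorphic.UnitaryGroup
open scoped MatrixGroups Matrix NNReal ENNReal Real Classical

namespace Literature.NumberTheory.Rogawski1990

section Cancel

variable (L : Type) [Field L] [NumberField L] [IsCMField L] (α : Fin 3 → L)
  [MeasurableSpace ↥(arch (↥(maximalRealSubfield L)) L (IsCMField.complexConj L) 3 (Matrix.diagonal α))]
  [BorelSpace ↥(arch (↥(maximalRealSubfield L)) L (IsCMField.complexConj L) 3 (Matrix.diagonal α))]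
  (S : Finset {w : InfinitePlace L // IsComplex w}) (w : {w : InfinitePlace L // IsComplex w})
  (s : ↥(arch (↥(maximalRealSubfield L)) L (IsCMField.complexConj L) 3 (Matrix.diagonal α)))
  (hT : chartTorusG L α S ≤ Subgroup.centralizer ({s} : Set ↥(arch (↥(maximalRealSubfield L)) L (IsCMField.complexConj L) 3 (Matrix.diagonal α))))
  (hTβ : chartTorusG L α (insert w S) ≤ Subgroup.centralizer ({s} : Set ↥(arch (↥(maximalRealSubfield L)) L (IsCMField.complexConj L) 3 (Matrix.diagonal α))))
  [MeasurableSpace (↥(Subgroup.centralizer ({s} : Set ↥(arch (↥(maximalRealSubfield L)) L (IsCMField.complexConj L) 3 (Matrix.diagonal α)))) ⧸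
    (chartTorusG L α S).subgroupOf (Subgroup.centralizer ({s} : Set ↥(arch (↥(maximalRealSubfield L)) L (IsCMField.complexConj L) 3 (Matrix.diagonal α)))))]
  [BorelSpace (↥(Subgroup.centralizer ({s} : Set ↥(arch (↥(maximalRealSubfield L)) L (IsCMField.complexConj L) 3 (Matrix.diagonal α)))) ⧸
    (chartTorusG L α S).subgroupOf (Subgroup.centralizer ({s} : Set ↥(arch (↥(maximalRealSubfield L)) L (IsCMField.complexConj L) 3 (Matrix.diagonal α)))))]
  [MeasurableSpace (↥(Subgroup.centralizer ({s} : Set ↥(arch (↥(maximalRealSubfield L)) L (IsCMField.complexConj L) 3 (Matrix.diagonal α)))) ⧸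
    (chartTorusG L α (insert w S)).subgroupOf (Subgroup.centralizer ({s} : Set ↥(arch (↥(maximalRealSubfield L)) L (IsCMField.complexConj L) 3 (Matrix.diagonal α)))))]
  [BorelSpace (↥(Subgroup.centralizer ({s} : Set ↥(arch (↥(maximalRealSubfield L)) L (IsCMField.complexConj L) 3 (Matrix.diagonal α)))) ⧸
    (chartTorusG L α (insert w S)).subgroupOf (Subgroup.centralizer ({s} : Set ↥(arch (↥(maximalRealSubfield L)) L (IsCMField.complexConj L) 3 (Matrix.diagonal α)))))]
  [LocallyCompactSpace ↥(Subgroup.centralizer ({s} : Set ↥(arch (↥(maximalRealSubfield L)) L (IsCMField.complexConj L) 3 (Matrix.diagonal α))))]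
  (νM : Measure ↥(Subgroup.centralizer ({s} : Set ↥(arch (↥(maximalRealSubfield L)) L (IsCMField.complexConj L) 3 (Matrix.diagonal α))))) [νM.IsHaarMeasure] [νM.IsMulRightInvariant]
  -- the standard block `U(J)` and the SHARED rank-one datum (LH4-p03 (g4) cert v3: `μ₀`, `μ₀′`, `hlink`)
  {J : Matrix (Fin 2) (Fin 2) ℂ} (hJ : J = (StdForm.antidiagonal 2).over ℂ)
  [MeasurableSpace ↥(unitaryGroupOfForm (starRingEnd ℂ) J)] [BorelSpace ↥(unitaryGroupOfForm (starRingEnd ℂ) J)]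
  [LocallyCompactSpace ↥(unitaryGroupOfForm (starRingEnd ℂ) J)] [SecondCountableTopology ↥(unitaryGroupOfForm (starRingEnd ℂ) J)]   -- ★ `locallyCompactSpace∕secondCountableTopology_unitaryGroupOfForm_complex J` (cert v4 binders)
  [MeasurableSpace (↥(unitaryGroupOfForm (starRingEnd ℂ) J) ⧸ torusU (starRingEnd ℂ) J)] [BorelSpace (↥(unitaryGroupOfForm (starRingEnd ℂ) J) ⧸ torusU (starRingEnd ℂ) J)]
  (μ₀ : Measure ↥(unitaryGroupOfForm (starRingEnd ℂ) J)) [μ₀.IsHaarMeasure] [μ₀.IsMulRightInvariant]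
  (μ₀' : Measure (↥(unitaryGroupOfForm (starRingEnd ℂ) J) ⧸ torusU (starRingEnd ℂ) J))
  (hlink : ∀ (ρ : Measure ↥(torusU (starRingEnd ℂ) J)) [ρ.IsHaarMeasure] [ρ.IsInvInvariant],
    μ₀' = ρ ((fun q : ℝ × ℝ => (⟨⟨hypBlockGL q.1 q.2, hypBlockGL_mem_of_eq_over hJ q.1 q.2⟩, hypBlockGL_mem_torusU hJ q.1 q.2⟩ : ↥(torusU (starRingEnd ℂ) J))) ''
        (Set.Icc (0 : ℝ) 1 ×ˢ Set.Icc (0 : ℝ) (2 * π))) •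
      quotientMeasure (torusU (starRingEnd ℂ) J) ρ (LineRing.isClosed_torusU_two (starRingEnd ℂ) J) μ₀)
  -- ONE box-positive inversion-invariant Haar measure on the split torus (LH4-p03's (DATUM-DISCHARGE): `σ B_std = 1`)
  (σ : Measure ↥(torusU (starRingEnd ℂ) J)) [σ.IsHaarMeasure] [σ.IsInvInvariant]
  (hσ0 : σ ((fun q : ℝ × ℝ => (⟨⟨hypBlockGL q.1 q.2, hypBlockGL_mem_of_eq_over hJ q.1 q.2⟩, hypBlockGL_mem_torusU hJ q.1 q.2⟩ : ↥(torusU (starRingEnd ℂ) J))) ''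
        (Set.Icc (0 : ℝ) 1 ×ˢ Set.Icc (0 : ℝ) (2 * π))) ≠ 0)
  (hσt : σ ((fun q : ℝ × ℝ => (⟨⟨hypBlockGL q.1 q.2, hypBlockGL_mem_of_eq_over hJ q.1 q.2⟩, hypBlockGL_mem_torusU hJ q.1 q.2⟩ : ↥(torusU (starRingEnd ℂ) J))) ''
        (Set.Icc (0 : ℝ) 1 ×ˢ Set.Icc (0 : ℝ) (2 * π))) ≠ ⊤)
  -- the compact Cayley torus of `U(J)` (abelian, compact; after (B-STD): `A = φ(diag S¹ × S¹)`)
  (A : Subgroup ↥(unitaryGroupOfForm (starRingEnd ℂ) J)) [CompactSpace ↥A] (hAcomm : ∀ a b : ↥A, a * b = b * a)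
  [MeasurableSpace (↥(unitaryGroupOfForm (starRingEnd ℂ) J) ⧸ A)] [BorelSpace (↥(unitaryGroupOfForm (starRingEnd ℂ) J) ⧸ A)]
  -- the block splitting `e′ = (φ × id) ∘ e_M` in BINDER form ((M-UNFOLD) ★ p850446 clauses [1] [3] [4]∕[7] and the Cayley twin [7β], through (B-STD) ★ p850488)
  (K : Subgroup ↥(Subgroup.centralizer ({s} : Set ↥(arch (↥(maximalRealSubfield L)) L (IsCMField.complexConj L) 3 (Matrix.diagonal α)))))
  (hKc : IsClosed (K : Set ↥(Subgroup.centralizer ({s} : Set ↥(arch (↥(maximalRealSubfield L)) L (IsCMField.complexConj L) 3 (Matrix.diagonal α))))))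
  (hKcomm : ∀ k₁, k₁ ∈ K → ∀ k₂, k₂ ∈ K → k₁ * k₂ = k₂ * k₁)
  (e' : ↥(Subgroup.centralizer ({s} : Set ↥(arch (↥(maximalRealSubfield L)) L (IsCMField.complexConj L) 3 (Matrix.diagonal α)))) ≃ₜ* ↥(unitaryGroupOfForm (starRingEnd ℂ) J) × ↥K)
  (hTA : ∀ g : ↥(Subgroup.centralizer ({s} : Set ↥(arch (↥(maximalRealSubfield L)) L (IsCMField.complexConj L) 3 (Matrix.diagonal α)))),
    g ∈ (chartTorusG L α S).subgroupOf (Subgroup.centralizer ({s} : Set ↥(arch (↥(maximalRealSubfield L)) L (IsCMField.complexConj L) 3 (Matrix.diagonal α)))) ↔ (e' g).1 ∈ A)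
  (hTAβ : ∀ g : ↥(Subgroup.centralizer ({s} : Set ↥(arch (↥(maximalRealSubfield L)) L (IsCMField.complexConj L) 3 (Matrix.diagonal α)))),
    g ∈ (chartTorusG L α (insert w S)).subgroupOf (Subgroup.centralizer ({s} : Set ↥(arch (↥(maximalRealSubfield L)) L (IsCMField.complexConj L) 3 (Matrix.diagonal α)))) ↔
      (e' g).1 ∈ torusU (starRingEnd ℂ) J)
  (Ψ : (↥(Subgroup.centralizer ({s} : Set ↥(arch (↥(maximalRealSubfield L)) L (IsCMField.complexConj L) 3 (Matrix.diagonal α)))) ⧸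
      (chartTorusG L α S).subgroupOf (Subgroup.centralizer ({s} : Set ↥(arch (↥(maximalRealSubfield L)) L (IsCMField.complexConj L) 3 (Matrix.diagonal α))))) ≃ₜ
      ↥(unitaryGroupOfForm (starRingEnd ℂ) J) ⧸ A)
  (hΨ : ∀ b : ↥(unitaryGroupOfForm (starRingEnd ℂ) J), Ψ.symm (QuotientGroup.mk b) = QuotientGroup.mk (e'.symm (b, 1)))
  (Ψβ : (↥(Subgroup.centralizer ({s} : Set ↥(arch (↥(maximalRealSubfield L)) L (IsCMField.complexConj L) 3 (Matrix.diagonal α)))) ⧸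
      (chartTorusG L α (insert w S)).subgroupOf (Subgroup.centralizer ({s} : Set ↥(arch (↥(maximalRealSubfield L)) L (IsCMField.complexConj L) 3 (Matrix.diagonal α))))) ≃ₜ
      ↥(unitaryGroupOfForm (starRingEnd ℂ) J) ⧸ torusU (starRingEnd ℂ) J)
  (hΨβ : ∀ b : ↥(unitaryGroupOfForm (starRingEnd ℂ) J), Ψβ.symm (QuotientGroup.mk b) = QuotientGroup.mk (e'.symm (b, 1)))
  -- the common `K`-shadow of the two chart boxes and the two BOX CLAUSES ((M-UNFOLD) [5]∕[6] and Cayley twins)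
  (KBox : Set ↥K)
  (hboxS : {t : ↥(chartTorusG L α S) | (e' ⟨(t : ↥(arch (↥(maximalRealSubfield L)) L (IsCMField.complexConj L) 3 (Matrix.diagonal α))), hT t.2⟩).2 ∈ KBox} = chartBoxImgG L α S)
  (hboxβ : {t : ↥(chartTorusG L α (insert w S)) |
      ((e' ⟨(t : ↥(arch (↥(maximalRealSubfield L)) L (IsCMField.complexConj L) 3 (Matrix.diagonal α))), hTβ t.2⟩).1 : ↥(unitaryGroupOfForm (starRingEnd ℂ) J)) ∈
          Subtype.val '' ((fun q : ℝ × ℝ => (⟨⟨hypBlockGL q.1 q.2, hypBlockGL_mem_of_eq_over hJ q.1 q.2⟩, hypBlockGL_mem_torusU hJ q.1 q.2⟩ : ↥(torusU (starRingEnd ℂ) J))) ''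
            (Set.Icc (0 : ℝ) 1 ×ˢ Set.Icc (0 : ℝ) (2 * π))) ∧
        (e' ⟨(t : ↥(arch (↥(maximalRealSubfield L)) L (IsCMField.complexConj L) 3 (Matrix.diagonal α))), hTβ t.2⟩).2 ∈ KBox} = chartBoxImgG L α (insert w S))

set_option maxHeartbeats 800000 in
include hlink hσ0 hσt hAcomm hKc hKcomm hTA hTAβ hΨ hΨβ hboxS hboxβ in
/-- **(G′-CANCEL): THE TWO DESCENT CONSTANTS OF `chartOrbG` AGREE.**  In the setting of ★ p850417 (compact chart `S`, `T_S ≤ Z(s)`) and ★ p850444 (Cayley chart `insert w S`,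
`T♯ ≤ Z(s)`), with ONE block splitting `e′ : Z(s) ≃ₜ* U(J) × K` (`K ≤ Z(s)` closed abelian; `T′_S = e′⁻¹(A × K)`, `A ≤ U(J)` compact abelian; `T′♯ = e′⁻¹(T_split × K)`), the quotient
homeomorphisms `Ψ`, `Ψβ` (`Ψ⁻¹⟦b⟧ = ⟦e′⁻¹(b,1)⟧`), ANY Haar `νM` on `Z(s)`, the SHARED `μ₀` and its box-normalised quotient `μ₀′` (`hlink`), and the two chart boxes sharing their
`K`-shadow `K□` (`B′_S = {t ∣ (e′t).2 ∈ K□}`, `B′♯ = {t ∣ (e′t).1 ∈ B_std, (e′t).2 ∈ K□}`): there are `κ, κβ > 0` with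
**`Ψ_* (νM ∕ dt′_S) = κ • π_* μ₀`** (★ p850417's `hmap`, `νB := μ₀`), **`Ψβ_* (νM ∕ dt′♯) = κβ • μ₀′`** (★ p850444's `hmapβ`, `μ := μ₀′`) and
**`dt′_S(B′_S) · κ = dt′♯(B′♯) · κβ`** — LH3-p02 (g3)'s single descent constant `K` on both charts (ED. 3 `…_of_bricks_std`).  Proof: ★ `exists_smul_map_mk_of_block_compact`
and ★ `exists_smul_eq_of_block_boxNormalised` pin `κ`, `κβ` by `κ·dt′_S{(e′t).2 ∈ F}·μ₀(E) = νM(e′⁻¹(E × F)) = κβ·dt′♯{(e′t).1 ∈ B_std, (e′t).2 ∈ F}·μ₀(E)`; take `F := K□`, `E` a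
positive compact, and read the box clauses (★ `toReal_mul_eq_toReal_mul_of_pinning`). [cite: Rogawski1990, §8.2 p. 122; §4.12 Lemma 4.12.1 p. 66] [cite: Folland1995, §2.6 Thm. 2.49, (2.52)]
[cite: DeitmarEchterhoff2014, Thm. 1.5.3] [cite: Shelstad1979, §4 pp. 22–25] -/
theorem exists_hmap_hmapβ_descentConst_eq :
    ∃ κ κβ : ℝ≥0, κ ≠ 0 ∧ κβ ≠ 0 ∧
      (haveI := isHaarMeasure_chartHaarG L α S
       haveI := isInvInvariant_chartHaarG L α S
       haveI := isHaarMeasure_map_subgroupOfEquivOfLe_symm hT (chartHaarG L α S)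
       haveI := isInvInvariant_map_subgroupOfEquivOfLe_symm hT (chartHaarG L α S)
      Measure.map Ψ (quotientMeasure ((chartTorusG L α S).subgroupOf (Subgroup.centralizer ({s} : Set ↥(arch (↥(maximalRealSubfield L)) L (IsCMField.complexConj L) 3 (Matrix.diagonal α)))))
          (Measure.map (Subgroup.subgroupOfEquivOfLe hT).symm (chartHaarG L α S))
          (isClosed_subgroupOf_of_isClosed _ _ (isClosed_chartTorusG L α S)) νM)) = κ • Measure.map (QuotientGroup.mk : ↥(unitaryGroupOfForm (starRingEnd ℂ) J) → _) μ₀ ∧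
      (haveI := isHaarMeasure_chartHaarG L α (insert w S)
       haveI := isInvInvariant_chartHaarG L α (insert w S)
       haveI := isHaarMeasure_map_subgroupOfEquivOfLe_symm hTβ (chartHaarG L α (insert w S))
       haveI := isInvInvariant_map_subgroupOfEquivOfLe_symm hTβ (chartHaarG L α (insert w S))
      Measure.map Ψβ (quotientMeasure ((chartTorusG L α (insert w S)).subgroupOf (Subgroup.centralizer ({s} : Set ↥(arch (↥(maximalRealSubfield L)) L (IsCMField.complexConj L) 3 (Matrix.diagonal α)))))
          (Measure.map (Subgroup.subgroupOfEquivOfLe hTβ).symm (chartHaarG L α (insert w S)))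
          (isClosed_subgroupOf_of_isClosed _ _ (isClosed_chartTorusG L α (insert w S))) νM)) = κβ • μ₀' ∧
      (haveI := isHaarMeasure_chartHaarG L α S; (chartHaarG L α S (chartBoxImgG L α S)).toReal) * (κ : ℝ) =
        (haveI := isHaarMeasure_chartHaarG L α (insert w S); (chartHaarG L α (insert w S) (chartBoxImgG L α (insert w S))).toReal) * (κβ : ℝ) := by
  -- instances on `Z(s)`'s subgroups `K`, `T′_S`, `T′♯`, and on `A`, `T_split`
  haveI : LocallyCompactSpace ↥K := hKc.isClosedEmbedding_subtypeVal.locallyCompactSpace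
  haveI := isHaarMeasure_chartHaarG L α S
  haveI := isInvInvariant_chartHaarG L α S
  haveI := isHaarMeasure_map_subgroupOfEquivOfLe_symm hT (chartHaarG L α S)
  haveI := isInvInvariant_map_subgroupOfEquivOfLe_symm hT (chartHaarG L α S)
  haveI := isHaarMeasure_chartHaarG L α (insert w S)
  haveI := isInvInvariant_chartHaarG L α (insert w S)
  haveI := isHaarMeasure_map_subgroupOfEquivOfLe_symm hTβ (chartHaarG L α (insert w S))
  haveI := isInvInvariant_map_subgroupOfEquivOfLe_symm hTβ (chartHaarG L α (insert w S))
  have hTc := isClosed_subgroupOf_of_isClosed _ (Subgroup.centralizer ({s} : Set ↥(arch (↥(maximalRealSubfield L)) L (IsCMField.complexConj L) 3 (Matrix.diagonal α))))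
    (isClosed_chartTorusG L α S)
  have hTβc := isClosed_subgroupOf_of_isClosed _ (Subgroup.centralizer ({s} : Set ↥(arch (↥(maximalRealSubfield L)) L (IsCMField.complexConj L) 3 (Matrix.diagonal α))))
    (isClosed_chartTorusG L α (insert w S))
  have hAcpt : IsCompact (A : Set ↥(unitaryGroupOfForm (starRingEnd ℂ) J)) := isCompact_iff_compactSpace.mpr inferInstance
  have hA : IsClosed (A : Set ↥(unitaryGroupOfForm (starRingEnd ℂ) J)) := hAcpt.isClosed
  have hTor : IsClosed (torusU (starRingEnd ℂ) J : Set ↥(unitaryGroupOfForm (starRingEnd ℂ) J)) := LineRing.isClosed_torusU_two (starRingEnd ℂ) J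
  haveI : LocallyCompactSpace ↥(torusU (starRingEnd ℂ) J) := hTor.isClosedEmbedding_subtypeVal.locallyCompactSpace
  -- an inversion-invariant, right-invariant Haar measure on the abelian `K`
  letI : CommGroup ↥K := { (inferInstance : Group ↥K) with mul_comm := fun a b => Subtype.ext (hKcomm _ a.2 _ b.2) }
  let νK : Measure ↥K := haarMeasure (Classical.arbitrary (TopologicalSpace.PositiveCompacts ↥K))
  haveI : νK.IsInvInvariant := IsHaarMeasure.isInvInvariant_of_regular νK
  haveI : νK.IsMulRightInvariant := isMulRightInvariant_of_isInvInvariant νK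
  -- an inversion-invariant Haar measure on the compact abelian `A`
  letI : CommGroup ↥A := { (inferInstance : Group ↥A) with mul_comm := hAcomm }
  let ρA : Measure ↥A := haarMeasure (Classical.arbitrary (TopologicalSpace.PositiveCompacts ↥A))
  haveI : ρA.IsInvInvariant := IsHaarMeasure.isInvInvariant_of_regular ρA
  -- the two pinned descents (★ `InvariantQuotientBlockDescent`)
  obtain ⟨κ, hκ0, hmap, hpin⟩ := exists_smul_map_mk_of_block_compact e'
    ((chartTorusG L α S).subgroupOf _) hTc A hA hTA Ψ hΨ (Measure.map (Subgroup.subgroupOfEquivOfLe hT).symm (chartHaarG L α S)) νM ρA μ₀ νK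
  have hpre : Subtype.val ⁻¹' (Subtype.val '' ((fun q : ℝ × ℝ => (⟨⟨hypBlockGL q.1 q.2, hypBlockGL_mem_of_eq_over hJ q.1 q.2⟩, hypBlockGL_mem_torusU hJ q.1 q.2⟩ : ↥(torusU (starRingEnd ℂ) J))) ''
        (Set.Icc (0 : ℝ) 1 ×ˢ Set.Icc (0 : ℝ) (2 * π)))) =
      (fun q : ℝ × ℝ => (⟨⟨hypBlockGL q.1 q.2, hypBlockGL_mem_of_eq_over hJ q.1 q.2⟩, hypBlockGL_mem_torusU hJ q.1 q.2⟩ : ↥(torusU (starRingEnd ℂ) J))) ''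
        (Set.Icc (0 : ℝ) 1 ×ˢ Set.Icc (0 : ℝ) (2 * π)) :=
    Subtype.val_injective.preimage_image _
  obtain ⟨κβ, hκβ0, hmapβ, hpinβ⟩ := exists_smul_eq_of_block_boxNormalised e'
    ((chartTorusG L α (insert w S)).subgroupOf _) hTβc (torusU (starRingEnd ℂ) J) hTor hTAβ Ψβ hΨβ
    (Measure.map (Subgroup.subgroupOfEquivOfLe hTβ).symm (chartHaarG L α (insert w S))) νM σ μ₀ νK
    (Subtype.val '' ((fun q : ℝ × ℝ => (⟨⟨hypBlockGL q.1 q.2, hypBlockGL_mem_of_eq_over hJ q.1 q.2⟩, hypBlockGL_mem_torusU hJ q.1 q.2⟩ : ↥(torusU (starRingEnd ℂ) J))) ''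
        (Set.Icc (0 : ℝ) 1 ×ˢ Set.Icc (0 : ℝ) (2 * π))))
    (by rw [hpre]; exact hσ0) (by rw [hpre]; exact hσt) μ₀' (by rw [hpre]; exact hlink σ)
  -- a test set of finite positive `μ₀`-mass
  obtain ⟨C⟩ := (inferInstance : Nonempty (TopologicalSpace.PositiveCompacts ↥(unitaryGroupOfForm (starRingEnd ℂ) J)))
  have hCpos : μ₀ C ≠ 0 := (measure_pos_of_nonempty_interior μ₀ C.interior_nonempty).ne'
  have hCfin : μ₀ C ≠ ⊤ := C.isCompact.measure_lt_top.ne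
  -- the two torus masses are the box masses
  have hmeasS : Measurable (⇑(Subgroup.subgroupOfEquivOfLe hT).symm) := (continuous_subgroupOfEquivOfLe hT).2.measurable
  have hmeasβ : Measurable (⇑(Subgroup.subgroupOfEquivOfLe hTβ).symm) := (continuous_subgroupOfEquivOfLe hTβ).2.measurable
  let eS : ↥((chartTorusG L α S).subgroupOf (Subgroup.centralizer ({s} : Set ↥(arch (↥(maximalRealSubfield L)) L (IsCMField.complexConj L) 3 (Matrix.diagonal α))))) ≃ₜ
      ↥(chartTorusG L α S) :=
    { Subgroup.subgroupOfEquivOfLe hT with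
      continuous_toFun := (continuous_subgroupOfEquivOfLe hT).1
      continuous_invFun := (continuous_subgroupOfEquivOfLe hT).2 }
  let eβ : ↥((chartTorusG L α (insert w S)).subgroupOf (Subgroup.centralizer ({s} : Set ↥(arch (↥(maximalRealSubfield L)) L (IsCMField.complexConj L) 3 (Matrix.diagonal α))))) ≃ₜ
      ↥(chartTorusG L α (insert w S)) :=
    { Subgroup.subgroupOfEquivOfLe hTβ with
      continuous_toFun := (continuous_subgroupOfEquivOfLe hTβ).1
      continuous_invFun := (continuous_subgroupOfEquivOfLe hTβ).2 }
  have hmassS : (Measure.map (Subgroup.subgroupOfEquivOfLe hT).symm (chartHaarG L α S))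
      {t | (e' (t : ↥(Subgroup.centralizer ({s} : Set ↥(arch (↥(maximalRealSubfield L)) L (IsCMField.complexConj L) 3 (Matrix.diagonal α)))))).2 ∈ KBox} =
        chartHaarG L α S (chartBoxImgG L α S) := by
    rw [show Measure.map (⇑(Subgroup.subgroupOfEquivOfLe hT).symm) (chartHaarG L α S) = Measure.map (⇑eS.symm.toMeasurableEquiv) (chartHaarG L α S) from rfl,
      MeasurableEquiv.map_apply, ← hboxS]
    rfl
  have hmassβ : (Measure.map (Subgroup.subgroupOfEquivOfLe hTβ).symm (chartHaarG L α (insert w S)))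
      {t | ((e' (t : ↥(Subgroup.centralizer ({s} : Set ↥(arch (↥(maximalRealSubfield L)) L (IsCMField.complexConj L) 3 (Matrix.diagonal α)))))).1 :
            ↥(unitaryGroupOfForm (starRingEnd ℂ) J)) ∈
          Subtype.val '' ((fun q : ℝ × ℝ => (⟨⟨hypBlockGL q.1 q.2, hypBlockGL_mem_of_eq_over hJ q.1 q.2⟩, hypBlockGL_mem_torusU hJ q.1 q.2⟩ : ↥(torusU (starRingEnd ℂ) J))) ''
            (Set.Icc (0 : ℝ) 1 ×ˢ Set.Icc (0 : ℝ) (2 * π))) ∧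
        (e' (t : ↥(Subgroup.centralizer ({s} : Set ↥(arch (↥(maximalRealSubfield L)) L (IsCMField.complexConj L) 3 (Matrix.diagonal α)))))).2 ∈ KBox} =
        chartHaarG L α (insert w S) (chartBoxImgG L α (insert w S)) := by
    rw [show Measure.map (⇑(Subgroup.subgroupOfEquivOfLe hTβ).symm) (chartHaarG L α (insert w S)) = Measure.map (⇑eβ.symm.toMeasurableEquiv) (chartHaarG L α (insert w S)) from rfl,
      MeasurableEquiv.map_apply, ← hboxβ]
    rfl
  have h₁ := hpin (C : Set ↥(unitaryGroupOfForm (starRingEnd ℂ) J)) KBox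
  have h₂ := hpinβ (C : Set ↥(unitaryGroupOfForm (starRingEnd ℂ) J)) KBox
  rw [hmassS] at h₁
  rw [hmassβ] at h₂
  exact ⟨κ, κβ, hκ0, hκβ0, hmap, hmapβ, toReal_mul_eq_toReal_mul_of_pinning h₁ h₂ hCpos hCfin⟩

end Cancel


/-! ## (ED. 2) The same head under OPAQUE Borel binders on the split torus — the binder list of `JumpGSideStatement` (skeleton v3.4) -/

section CancelBorel

set_option maxHeartbeats 800000 in
/-- **(G′-CANCEL) UNDER THE SKELETON'S BINDERS.**  `F0P3cStubN9Direct.JumpGSideStatement` (skeleton v3.4, LH4-p03 (g4)'s cert) binds an OPAQUE σ-algebra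
`[MeasurableSpace ↥(torusU … J)] [BorelSpace ↥(torusU … J)]` through which its `hlink` reads `Measure ↥(torusU … J)`, whereas `exists_hmap_hmapβ_descentConst_eq` reads the subtype
σ-algebra; both are `borel` (`BorelSpace.measurable_eq`), so the head transfers verbatim (`subst`).  Same statement, same conclusion, two more instance binders.
[cite: Rogawski1990, §8.2 p. 122] [cite: Folland1995, §2.6 (2.52)] [cite: DeitmarEchterhoff2014, Thm. 1.5.3] -/
theorem exists_hmap_hmapβ_descentConst_eq_of_borel
    (L : Type) [Field L] [NumberField L] [IsCMField L] (α : Fin 3 → L)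
      [MeasurableSpace ↥(arch (↥(maximalRealSubfield L)) L (IsCMField.complexConj L) 3 (Matrix.diagonal α))]
      [BorelSpace ↥(arch (↥(maximalRealSubfield L)) L (IsCMField.complexConj L) 3 (Matrix.diagonal α))]
      (S : Finset {w : InfinitePlace L // IsComplex w}) (w : {w : InfinitePlace L // IsComplex w})
      (s : ↥(arch (↥(maximalRealSubfield L)) L (IsCMField.complexConj L) 3 (Matrix.diagonal α)))
      (hT : chartTorusG L α S ≤ Subgroup.centralizer ({s} : Set ↥(arch (↥(maximalRealSubfield L)) L (IsCMField.complexConj L) 3 (Matrix.diagonal α))))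
      (hTβ : chartTorusG L α (insert w S) ≤ Subgroup.centralizer ({s} : Set ↥(arch (↥(maximalRealSubfield L)) L (IsCMField.complexConj L) 3 (Matrix.diagonal α))))
      [MeasurableSpace (↥(Subgroup.centralizer ({s} : Set ↥(arch (↥(maximalRealSubfield L)) L (IsCMField.complexConj L) 3 (Matrix.diagonal α)))) ⧸
        (chartTorusG L α S).subgroupOf (Subgroup.centralizer ({s} : Set ↥(arch (↥(maximalRealSubfield L)) L (IsCMField.complexConj L) 3 (Matrix.diagonal α)))))]
      [BorelSpace (↥(Subgroup.centralizer ({s} : Set ↥(arch (↥(maximalRealSubfield L)) L (IsCMField.complexConj L) 3 (Matrix.diagonal α)))) ⧸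
        (chartTorusG L α S).subgroupOf (Subgroup.centralizer ({s} : Set ↥(arch (↥(maximalRealSubfield L)) L (IsCMField.complexConj L) 3 (Matrix.diagonal α)))))]
      [MeasurableSpace (↥(Subgroup.centralizer ({s} : Set ↥(arch (↥(maximalRealSubfield L)) L (IsCMField.complexConj L) 3 (Matrix.diagonal α)))) ⧸
        (chartTorusG L α (insert w S)).subgroupOf (Subgroup.centralizer ({s} : Set ↥(arch (↥(maximalRealSubfield L)) L (IsCMField.complexConj L) 3 (Matrix.diagonal α)))))]
      [BorelSpace (↥(Subgroup.centralizer ({s} : Set ↥(arch (↥(maximalRealSubfield L)) L (IsCMField.complexConj L) 3 (Matrix.diagonal α)))) ⧸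
        (chartTorusG L α (insert w S)).subgroupOf (Subgroup.centralizer ({s} : Set ↥(arch (↥(maximalRealSubfield L)) L (IsCMField.complexConj L) 3 (Matrix.diagonal α)))))]
      [LocallyCompactSpace ↥(Subgroup.centralizer ({s} : Set ↥(arch (↥(maximalRealSubfield L)) L (IsCMField.complexConj L) 3 (Matrix.diagonal α))))]
      (νM : Measure ↥(Subgroup.centralizer ({s} : Set ↥(arch (↥(maximalRealSubfield L)) L (IsCMField.complexConj L) 3 (Matrix.diagonal α))))) [νM.IsHaarMeasure] [νM.IsMulRightInvariant]
      {J : Matrix (Fin 2) (Fin 2) ℂ} (hJ : J = (StdForm.antidiagonal 2).over ℂ)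
      [MeasurableSpace ↥(unitaryGroupOfForm (starRingEnd ℂ) J)] [BorelSpace ↥(unitaryGroupOfForm (starRingEnd ℂ) J)]
      [LocallyCompactSpace ↥(unitaryGroupOfForm (starRingEnd ℂ) J)] [SecondCountableTopology ↥(unitaryGroupOfForm (starRingEnd ℂ) J)]
      [instT : MeasurableSpace ↥(torusU (starRingEnd ℂ) J)] [instTB : BorelSpace ↥(torusU (starRingEnd ℂ) J)]   -- ★ `locallyCompactSpace∕secondCountableTopology_unitaryGroupOfForm_complex J` (cert v4 binders)
      [MeasurableSpace (↥(unitaryGroupOfForm (starRingEnd ℂ) J) ⧸ torusU (starRingEnd ℂ) J)] [BorelSpace (↥(unitaryGroupOfForm (starRingEnd ℂ) J) ⧸ torusU (starRingEnd ℂ) J)]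
      (μ₀ : Measure ↥(unitaryGroupOfForm (starRingEnd ℂ) J)) [μ₀.IsHaarMeasure] [μ₀.IsMulRightInvariant]
      (μ₀' : Measure (↥(unitaryGroupOfForm (starRingEnd ℂ) J) ⧸ torusU (starRingEnd ℂ) J))
      (hlink : ∀ (ρ : Measure ↥(torusU (starRingEnd ℂ) J)) [ρ.IsHaarMeasure] [ρ.IsInvInvariant],
        μ₀' = ρ ((fun q : ℝ × ℝ => (⟨⟨hypBlockGL q.1 q.2, hypBlockGL_mem_of_eq_over hJ q.1 q.2⟩, hypBlockGL_mem_torusU hJ q.1 q.2⟩ : ↥(torusU (starRingEnd ℂ) J))) ''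
            (Set.Icc (0 : ℝ) 1 ×ˢ Set.Icc (0 : ℝ) (2 * π))) •
          quotientMeasure (torusU (starRingEnd ℂ) J) ρ (LineRing.isClosed_torusU_two (starRingEnd ℂ) J) μ₀)
      (σ : Measure ↥(torusU (starRingEnd ℂ) J)) [σ.IsHaarMeasure] [σ.IsInvInvariant]
      (hσ0 : σ ((fun q : ℝ × ℝ => (⟨⟨hypBlockGL q.1 q.2, hypBlockGL_mem_of_eq_over hJ q.1 q.2⟩, hypBlockGL_mem_torusU hJ q.1 q.2⟩ : ↥(torusU (starRingEnd ℂ) J))) ''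
            (Set.Icc (0 : ℝ) 1 ×ˢ Set.Icc (0 : ℝ) (2 * π))) ≠ 0)
      (hσt : σ ((fun q : ℝ × ℝ => (⟨⟨hypBlockGL q.1 q.2, hypBlockGL_mem_of_eq_over hJ q.1 q.2⟩, hypBlockGL_mem_torusU hJ q.1 q.2⟩ : ↥(torusU (starRingEnd ℂ) J))) ''
            (Set.Icc (0 : ℝ) 1 ×ˢ Set.Icc (0 : ℝ) (2 * π))) ≠ ⊤)
      (A : Subgroup ↥(unitaryGroupOfForm (starRingEnd ℂ) J)) [CompactSpace ↥A] (hAcomm : ∀ a b : ↥A, a * b = b * a)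
      [MeasurableSpace (↥(unitaryGroupOfForm (starRingEnd ℂ) J) ⧸ A)] [BorelSpace (↥(unitaryGroupOfForm (starRingEnd ℂ) J) ⧸ A)]
      (K : Subgroup ↥(Subgroup.centralizer ({s} : Set ↥(arch (↥(maximalRealSubfield L)) L (IsCMField.complexConj L) 3 (Matrix.diagonal α)))))
      (hKc : IsClosed (K : Set ↥(Subgroup.centralizer ({s} : Set ↥(arch (↥(maximalRealSubfield L)) L (IsCMField.complexConj L) 3 (Matrix.diagonal α))))))
      (hKcomm : ∀ k₁, k₁ ∈ K → ∀ k₂, k₂ ∈ K → k₁ * k₂ = k₂ * k₁)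
      (e' : ↥(Subgroup.centralizer ({s} : Set ↥(arch (↥(maximalRealSubfield L)) L (IsCMField.complexConj L) 3 (Matrix.diagonal α)))) ≃ₜ* ↥(unitaryGroupOfForm (starRingEnd ℂ) J) × ↥K)
      (hTA : ∀ g : ↥(Subgroup.centralizer ({s} : Set ↥(arch (↥(maximalRealSubfield L)) L (IsCMField.complexConj L) 3 (Matrix.diagonal α)))),
        g ∈ (chartTorusG L α S).subgroupOf (Subgroup.centralizer ({s} : Set ↥(arch (↥(maximalRealSubfield L)) L (IsCMField.complexConj L) 3 (Matrix.diagonal α)))) ↔ (e' g).1 ∈ A)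
      (hTAβ : ∀ g : ↥(Subgroup.centralizer ({s} : Set ↥(arch (↥(maximalRealSubfield L)) L (IsCMField.complexConj L) 3 (Matrix.diagonal α)))),
        g ∈ (chartTorusG L α (insert w S)).subgroupOf (Subgroup.centralizer ({s} : Set ↥(arch (↥(maximalRealSubfield L)) L (IsCMField.complexConj L) 3 (Matrix.diagonal α)))) ↔
          (e' g).1 ∈ torusU (starRingEnd ℂ) J)
      (Ψ : (↥(Subgroup.centralizer ({s} : Set ↥(arch (↥(maximalRealSubfield L)) L (IsCMField.complexConj L) 3 (Matrix.diagonal α)))) ⧸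
          (chartTorusG L α S).subgroupOf (Subgroup.centralizer ({s} : Set ↥(arch (↥(maximalRealSubfield L)) L (IsCMField.complexConj L) 3 (Matrix.diagonal α))))) ≃ₜ
          ↥(unitaryGroupOfForm (starRingEnd ℂ) J) ⧸ A)
      (hΨ : ∀ b : ↥(unitaryGroupOfForm (starRingEnd ℂ) J), Ψ.symm (QuotientGroup.mk b) = QuotientGroup.mk (e'.symm (b, 1)))
      (Ψβ : (↥(Subgroup.centralizer ({s} : Set ↥(arch (↥(maximalRealSubfield L)) L (IsCMField.complexConj L) 3 (Matrix.diagonal α)))) ⧸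
          (chartTorusG L α (insert w S)).subgroupOf (Subgroup.centralizer ({s} : Set ↥(arch (↥(maximalRealSubfield L)) L (IsCMField.complexConj L) 3 (Matrix.diagonal α))))) ≃ₜ
          ↥(unitaryGroupOfForm (starRingEnd ℂ) J) ⧸ torusU (starRingEnd ℂ) J)
      (hΨβ : ∀ b : ↥(unitaryGroupOfForm (starRingEnd ℂ) J), Ψβ.symm (QuotientGroup.mk b) = QuotientGroup.mk (e'.symm (b, 1)))
      (KBox : Set ↥K)
      (hboxS : {t : ↥(chartTorusG L α S) | (e' ⟨(t : ↥(arch (↥(maximalRealSubfield L)) L (IsCMField.complexConj L) 3 (Matrix.diagonal α))), hT t.2⟩).2 ∈ KBox} = chartBoxImgG L α S)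
      (hboxβ : {t : ↥(chartTorusG L α (insert w S)) |
          ((e' ⟨(t : ↥(arch (↥(maximalRealSubfield L)) L (IsCMField.complexConj L) 3 (Matrix.diagonal α))), hTβ t.2⟩).1 : ↥(unitaryGroupOfForm (starRingEnd ℂ) J)) ∈
              Subtype.val '' ((fun q : ℝ × ℝ => (⟨⟨hypBlockGL q.1 q.2, hypBlockGL_mem_of_eq_over hJ q.1 q.2⟩, hypBlockGL_mem_torusU hJ q.1 q.2⟩ : ↥(torusU (starRingEnd ℂ) J))) ''
                (Set.Icc (0 : ℝ) 1 ×ˢ Set.Icc (0 : ℝ) (2 * π))) ∧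
            (e' ⟨(t : ↥(arch (↥(maximalRealSubfield L)) L (IsCMField.complexConj L) 3 (Matrix.diagonal α))), hTβ t.2⟩).2 ∈ KBox} = chartBoxImgG L α (insert w S)) :
    ∃ κ κβ : ℝ≥0, κ ≠ 0 ∧ κβ ≠ 0 ∧
      (haveI := isHaarMeasure_chartHaarG L α S
       haveI := isInvInvariant_chartHaarG L α S
       haveI := isHaarMeasure_map_subgroupOfEquivOfLe_symm hT (chartHaarG L α S)
       haveI := isInvInvariant_map_subgroupOfEquivOfLe_symm hT (chartHaarG L α S)
      Measure.map Ψ (quotientMeasure ((chartTorusG L α S).subgroupOf (Subgroup.centralizer ({s} : Set ↥(arch (↥(maximalRealSubfield L)) L (IsCMField.complexConj L) 3 (Matrix.diagonal α)))))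
          (Measure.map (Subgroup.subgroupOfEquivOfLe hT).symm (chartHaarG L α S))
          (isClosed_subgroupOf_of_isClosed _ _ (isClosed_chartTorusG L α S)) νM)) = κ • Measure.map (QuotientGroup.mk : ↥(unitaryGroupOfForm (starRingEnd ℂ) J) → _) μ₀ ∧
      (haveI := isHaarMeasure_chartHaarG L α (insert w S)
       haveI := isInvInvariant_chartHaarG L α (insert w S)
       haveI := isHaarMeasure_map_subgroupOfEquivOfLe_symm hTβ (chartHaarG L α (insert w S))
       haveI := isInvInvariant_map_subgroupOfEquivOfLe_symm hTβ (chartHaarG L α (insert w S))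
      Measure.map Ψβ (quotientMeasure ((chartTorusG L α (insert w S)).subgroupOf (Subgroup.centralizer ({s} : Set ↥(arch (↥(maximalRealSubfield L)) L (IsCMField.complexConj L) 3 (Matrix.diagonal α)))))
          (Measure.map (Subgroup.subgroupOfEquivOfLe hTβ).symm (chartHaarG L α (insert w S)))
          (isClosed_subgroupOf_of_isClosed _ _ (isClosed_chartTorusG L α (insert w S))) νM)) = κβ • μ₀' ∧
      (haveI := isHaarMeasure_chartHaarG L α S; (chartHaarG L α S (chartBoxImgG L α S)).toReal) * (κ : ℝ) =
        (haveI := isHaarMeasure_chartHaarG L α (insert w S); (chartHaarG L α (insert w S) (chartBoxImgG L α (insert w S))).toReal) * (κβ : ℝ) := by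
  have hms : instT = Subtype.instMeasurableSpace :=
    (@BorelSpace.measurable_eq _ _ instT instTB).trans (@BorelSpace.measurable_eq _ _ Subtype.instMeasurableSpace (Subtype.borelSpace _)).symm
  subst hms
  exact exists_hmap_hmapβ_descentConst_eq L α S w s hT hTβ νM hJ μ₀ μ₀' hlink σ hσ0 hσt A hAcomm K hKc hKcomm e' hTA hTAβ Ψ hΨ Ψβ hΨβ KBox hboxS hboxβ

end CancelBorel

end Literature.NumberTheory.Rogawski1990

end
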